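import Literature.NumberTheory.Automorphic.UnitaryGroupBorelThinSetIntegralEq
import Literature.NumberTheory.Automorphic.UnitaryGroupTruncatedKernelMeasurable
import HarnessLib

/-!
# The four nonnegative parts of the window `1_{T<H≤T'} K_B(·,·)` on `U(3)` factor in Iwasawa coordinates:
# `w_j(b k) = Φ(b) Θ_j(k)` with `Φ = 1_{T<H≤T'} δ_B` left-`B(F)`-invariant — the hypotheses of the weight exchange
(Rogawski, *Automorphic Representations of Unitary Groups in Three Variables* (1990), §2.1 p. 12 «each
term in (2.1.1) is a polynomial in `T`», §2.2 p. 13 `δ_B(d(a,b,ā⁻¹)) = ‖a‖²`; Arthur, *The trace formula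
in invariant form*, Ann. of Math. 114 (1981), §2)

Topic `NumberTheory/Automorphic`; namespace `Literature.NumberTheory.Automorphic.UnitaryGroup`. THEOREMS
ONLY over accepted tree modules (no definition, no named fact, no instance, no notation, no `sorry`).
Brick (L2-h) of the road to the T1-qs law ★ `UnitaryGroup.TruncatedTracePolynomial`: the GLUE between the
four `[0, ∞]`-valued parts of the window (F0P3a-p04's letters for (L2-e), F0P4-p06's (L2-uℂ))

  `window T T' y = 1_{T < H(y) ≤ T'} K_B(y, y)`,  `w₁ = ofReal (re window)`, `w₂ = ofReal (−re window)`,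
  `w₃ = ofReal (im window)`, `w₄ = ofReal (−im window)`,

and the weight-exchange identity ★ `lintegral_weight_iwasawa_eq_three` (`UnitaryGroupIwasawaWeightExchange`,
(L2-i)), whose binders `hΦm hΦinv hΘ hΨm hΨ` are discharged here at

  `Φ T T' b = 1_{T < H(b) ≤ T'} δ_B(b)` (on `B(𝔸_F)`),  `Θ₁ k = ofReal (re K_B(k,k))`, … (on `G(𝔸_F)`).

Everything is SPELLED OUT (no definition): `δ_B(b) = torusRootModulus E 3 (diagUnit b)`, `H = borelHeight`,
`K_B = kernelBorel ν 𝓕 f`, `K_U`-membership as `adelicVal k ∈ K_∞ · GL₃(𝒪̂_E)`.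

* §1 `window_borel_mul_of_mem_standardMaximalCompactGL` — the ℂ-level factorisation
  `window(b k) = 1_{T<H(b)≤T'} · δ_B(b) • K_B(k, k)` for `b ∈ B(𝔸_F)`, `k ∈ K_U` (★ `kernelBorel_borel_mul_mul`:
  `K_B(bx, by) = δ_B(b) • K_B(x, y)`; ★ `borelHeight_mul_of_mem_comap_standardMaximalCompactGL`: `H(b k) = H(b)`).
* §2 the `B(𝔸_F)`-weight `Φ`: `measurable_windowWeight`; `windowWeight_rational_mul` — left-`B(F)`-invariance
  (★ `borelHeight_rational_borel_mul`, ★ `torusRootModulus_diagUnit_rational_mul`: `δ_B = 1` on `B(F)`).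
* §3 measurability of the parts `Θ_j`, `w_j` (★ `measurable_kernelBorel_diag`, ★ `measurableSet_setOf_lt_borelHeight`).
* §4 **`windowPart_re_borel_mul_eq`, `windowPart_negRe_borel_mul_eq`, `windowPart_im_borel_mul_eq`,
  `windowPart_negIm_borel_mul_eq`** — `w_j(b k) = Φ(b) · Θ_j(k)` (`ENNReal.ofReal (δ r) = δ · ofReal r` for `δ ≥ 0`).

## References
* J. D. Rogawski, *Automorphic Representations of Unitary Groups in Three Variables*, Ann. of Math. Stud.
  123 (1990), §2.1 (p. 12), §2.2 (p. 13) [Rogawski1990].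
* J. Arthur, *The trace formula in invariant form*, Ann. of Math. 114 (1981), §2 [Arthur1981TraceFormulaInvariantForm].
-/

set_option autoImplicit false

noncomputable section

open MeasureTheory Measure NumberField IsDedekindDomain Set
open scoped NNReal ENNReal

namespace Literature.NumberTheory.Automorphic

namespace UnitaryGroup

variable {F E : Type} [Field F] [NumberField F] [Field E] [NumberField E] [Algebra F E]
  {c : E ≃ₐ[F] E}

variable [MeasurableSpace (adelicUnipotent F E c 3)] [BorelSpace (adelicUnipotent F E c 3)]

/-! ## §1 The window in Iwasawa coordinates (ℂ-level) -/

/-- **`window(b k) = 1_{T<H(b)≤T'} · δ_B(b) • K_B(k, k)`** for `b ∈ B(𝔸_F)` and `k ∈ K_U` (`f ∈ C_c`, `ν` Haar,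
`𝓕` a fundamental domain of `N(F)`): `H(b k) = H(b)` (★ `borelHeight_mul_of_mem_comap_standardMaximalCompactGL`)
and `K_B(b k, b k) = δ_B(b) • K_B(k, k)` (★ `kernelBorel_borel_mul_mul`). [cite: Rogawski1990, §2.2 (p. 13)] -/
theorem window_borel_mul_of_mem_standardMaximalCompactGL (hc : c * c = 1) (hc1 : c ≠ 1)
    (ν : Measure (adelicUnipotent F E c 3)) [ν.IsHaarMeasure] {𝓕 : Set (adelicUnipotent F E c 3)}
    (h𝓕 : IsFundamentalDomain (rationalUnipotent F E c 3) 𝓕 ν)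
    {f : (quasiSplit F E c 3).Adelic → ℂ} (hfc : Continuous f) (hf : HasCompactSupport f) (T T' : ℝ≥0)
    (b : borelAdelic F E c 3) {k : (quasiSplit F E c 3).Adelic}
    (hk : adelicVal F E c 3 ((StdForm.antidiagonal 3).over E) k ∈ standardMaximalCompactGL 3 E) :
    {y : (quasiSplit F E c 3).Adelic | T < borelHeight y ∧ borelHeight y ≤ T'}.indicator
        (fun y => kernelBorel ν 𝓕 f y y) ((b : (quasiSplit F E c 3).Adelic) * k) =
      {b : borelAdelic F E c 3 | T < borelHeight (b : (quasiSplit F E c 3).Adelic) ∧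
          borelHeight (b : (quasiSplit F E c 3).Adelic) ≤ T'}.indicator
        (fun b => (torusRootModulus E 3 (diagUnit b.2) : ℝ) • kernelBorel ν 𝓕 f k k) b := by
  have hH : borelHeight ((b : (quasiSplit F E c 3).Adelic) * k) = borelHeight (b : (quasiSplit F E c 3).Adelic) :=
    borelHeight_mul_of_mem_comap_standardMaximalCompactGL (Subgroup.mem_comap.2 hk) _
  by_cases hb : T < borelHeight (b : (quasiSplit F E c 3).Adelic) ∧ borelHeight (b : (quasiSplit F E c 3).Adelic) ≤ T'
  · rw [Set.indicator_of_mem (show (b : (quasiSplit F E c 3).Adelic) * k ∈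
        {y : (quasiSplit F E c 3).Adelic | T < borelHeight y ∧ borelHeight y ≤ T'} by rw [Set.mem_setOf_eq, hH]; exact hb),
      Set.indicator_of_mem (show b ∈ {b : borelAdelic F E c 3 | T < borelHeight (b : (quasiSplit F E c 3).Adelic) ∧
          borelHeight (b : (quasiSplit F E c 3).Adelic) ≤ T'} from hb)]
    exact kernelBorel_borel_mul_mul hc hc1 ν h𝓕 hfc hf b k k
  · rw [Set.indicator_of_notMem (show (b : (quasiSplit F E c 3).Adelic) * k ∉
        {y : (quasiSplit F E c 3).Adelic | T < borelHeight y ∧ borelHeight y ≤ T'} by rw [Set.mem_setOf_eq, hH]; exact hb),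
      Set.indicator_of_notMem (show b ∉ {b : borelAdelic F E c 3 | T < borelHeight (b : (quasiSplit F E c 3).Adelic) ∧
          borelHeight (b : (quasiSplit F E c 3).Adelic) ≤ T'} from hb)]

/-! ## §2 The `B(𝔸_F)`-weight `Φ = 1_{T<H≤T'} δ_B` -/

section Weight

variable [MeasurableSpace (quasiSplit F E c 3).Adelic] [BorelSpace (quasiSplit F E c 3).Adelic]

omit [MeasurableSpace (adelicUnipotent F E c 3)] [BorelSpace (adelicUnipotent F E c 3)] in
/-- `Φ(b) = 1_{T<H(b)≤T'} δ_B(b)` is measurable on `B(𝔸_F)` (★ `measurable_borelHeight`, ★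
`measurable_coe_torusRootModulus_diagUnit`). [cite: Rogawski1990, §2.2 (p. 13)] -/
theorem measurable_windowWeight (T T' : ℝ≥0) :
    Measurable ({b : borelAdelic F E c 3 | T < borelHeight (b : (quasiSplit F E c 3).Adelic) ∧
        borelHeight (b : (quasiSplit F E c 3).Adelic) ≤ T'}.indicator
      fun b => ((torusRootModulus E 3 (diagUnit b.2) : ℝ≥0) : ℝ≥0∞)) := by
  have hHm : Measurable fun b : borelAdelic F E c 3 => borelHeight (b : (quasiSplit F E c 3).Adelic) :=
    measurable_borelHeight.comp measurable_subtype_coe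
  exact measurable_coe_torusRootModulus_diagUnit.indicator
    (show MeasurableSet ((fun b : borelAdelic F E c 3 => borelHeight (b : (quasiSplit F E c 3).Adelic)) ⁻¹' Set.Ioc T T')
      from hHm measurableSet_Ioc)

end Weight

omit [MeasurableSpace (adelicUnipotent F E c 3)] [BorelSpace (adelicUnipotent F E c 3)] in
/-- **`Φ` is left-`B(F)`-invariant**: `Φ(b₀ b) = Φ(b)` for `b₀ ∈ B(𝔸_F)` rational (`H(b₀ b) = H(b)` ★
`borelHeight_rational_borel_mul`; `δ_B(b₀ b) = δ_B(b)` ★ `torusRootModulus_diagUnit_rational_mul`).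
[cite: Rogawski1990, §2.2 (p. 13)] -/
theorem windowWeight_rational_mul (T T' : ℝ≥0) (b₀ : borelAdelic F E c 3)
    (hb₀ : (b₀ : (quasiSplit F E c 3).Adelic) ∈ (quasiSplit F E c 3).arithmeticSubgroup) (b : borelAdelic F E c 3) :
    {b : borelAdelic F E c 3 | T < borelHeight (b : (quasiSplit F E c 3).Adelic) ∧
        borelHeight (b : (quasiSplit F E c 3).Adelic) ≤ T'}.indicator
      (fun b => ((torusRootModulus E 3 (diagUnit b.2) : ℝ≥0) : ℝ≥0∞)) (b₀ * b) =
    {b : borelAdelic F E c 3 | T < borelHeight (b : (quasiSplit F E c 3).Adelic) ∧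
        borelHeight (b : (quasiSplit F E c 3).Adelic) ≤ T'}.indicator
      (fun b => ((torusRootModulus E 3 (diagUnit b.2) : ℝ≥0) : ℝ≥0∞)) b := by
  obtain ⟨γ, hγ⟩ := hb₀
  have hγB : (quasiSplit F E c 3).toAdelic γ ∈ borelAdelic F E c 3 := by rw [hγ]; exact b₀.2
  have hH : borelHeight (((b₀ * b : borelAdelic F E c 3)) : (quasiSplit F E c 3).Adelic) =
      borelHeight (b : (quasiSplit F E c 3).Adelic) := by
    rw [Subgroup.coe_mul, ← hγ]
    exact borelHeight_rational_borel_mul γ hγB _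
  have hδ : torusRootModulus E 3 (diagUnit (b₀ * b).2) = torusRootModulus E 3 (diagUnit b.2) :=
    torusRootModulus_diagUnit_rational_mul ⟨b₀, Subgroup.mem_comap.2 ⟨γ, hγ⟩⟩ b
  simp only [Set.indicator_apply, Set.mem_setOf_eq, hH, hδ]

/-! ## §3 Measurability of the parts -/

section Parts

variable [MeasurableSpace (quasiSplit F E c 3).Adelic] [BorelSpace (quasiSplit F E c 3).Adelic]

omit [BorelSpace (adelicUnipotent F E c 3)] [MeasurableSpace (quasiSplit F E c 3).Adelic]
  [BorelSpace (quasiSplit F E c 3).Adelic] in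
/-- **A Haar measure of `N(𝔸_F) ≤ U(J₃)(𝔸_F)` is s-finite** (`N(𝔸_F)` is a closed subgroup of the second
countable locally compact `G(𝔸_F)`, so locally finite measures are σ-finite) — the `[SFinite ν]` binder of ★
`measurable_kernelBorel_diag` and of §3 below, discharged once for the consumers. [cite: Rogawski1990, §2.2 (p. 13)] -/
theorem sFinite_of_isHaarMeasure_adelicUnipotent (ν : Measure (adelicUnipotent F E c 3)) [ν.IsHaarMeasure] :
    SFinite ν := by
  haveI := secondCountableTopology_adeleRing E
  haveI := locallyCompactSpace_adeleRing' E
  haveI := t2Space_adeleRing_of_numberField E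
  haveI : T2Space (quasiSplit F E c 3).Adelic :=
    inferInstanceAs (T2Space (adelic F E c 3 ((StdForm.antidiagonal 3).over E)))
  haveI : LocallyCompactSpace (quasiSplit F E c 3).Adelic :=
    inferInstanceAs (LocallyCompactSpace (adelic F E c 3 ((StdForm.antidiagonal 3).over E)))
  haveI : SecondCountableTopology (quasiSplit F E c 3).Adelic :=
    inferInstanceAs (SecondCountableTopology (adelic F E c 3 ((StdForm.antidiagonal 3).over E)))
  have hNcl : IsClosed ((adelicUnipotent F E c 3 : Set (quasiSplit F E c 3).Adelic)) := by
    change IsClosed (⇑(adelicVal F E c 3 ((StdForm.antidiagonal 3).over E)) ⁻¹'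
      ((upperUnitriangular (Fin 3) (AdeleRing (𝓞 E) E) : Subgroup (GL (Fin 3) (AdeleRing (𝓞 E) E))) :
        Set (GL (Fin 3) (AdeleRing (𝓞 E) E))))
    exact (isClosed_upperUnitriangular (R := AdeleRing (𝓞 E) E)).preimage continuous_subtype_val
  haveI : SecondCountableTopology (adelicUnipotent F E c 3) := TopologicalSpace.Subtype.secondCountableTopology _
  haveI : LocallyCompactSpace (adelicUnipotent F E c 3) := hNcl.locallyCompactSpace
  infer_instance

/-- `Θ₁(k) = ofReal (re K_B(k,k))` is measurable (★ `measurable_kernelBorel_diag`). [cite: Rogawski1990, §2.2 (p. 13)] -/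
theorem measurable_ofReal_re_kernelBorel_diag {f : (quasiSplit F E c 3).Adelic → ℂ} (hfc : Continuous f)
    (hf : HasCompactSupport f) (ν : Measure (adelicUnipotent F E c 3)) [SFinite ν] (𝓕 : Set (adelicUnipotent F E c 3)) :
    Measurable fun k : (quasiSplit F E c 3).Adelic => ENNReal.ofReal (kernelBorel ν 𝓕 f k k).re :=
  ENNReal.measurable_ofReal.comp (Complex.measurable_re.comp (measurable_kernelBorel_diag hfc hf ν 𝓕))

/-- `Θ₂(k) = ofReal (−re K_B(k,k))` is measurable. [cite: Rogawski1990, §2.2 (p. 13)] -/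
theorem measurable_ofReal_neg_re_kernelBorel_diag {f : (quasiSplit F E c 3).Adelic → ℂ} (hfc : Continuous f)
    (hf : HasCompactSupport f) (ν : Measure (adelicUnipotent F E c 3)) [SFinite ν] (𝓕 : Set (adelicUnipotent F E c 3)) :
    Measurable fun k : (quasiSplit F E c 3).Adelic => ENNReal.ofReal (-(kernelBorel ν 𝓕 f k k).re) :=
  ENNReal.measurable_ofReal.comp (Complex.measurable_re.comp (measurable_kernelBorel_diag hfc hf ν 𝓕)).neg

/-- `Θ₃(k) = ofReal (im K_B(k,k))` is measurable. [cite: Rogawski1990, §2.2 (p. 13)] -/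
theorem measurable_ofReal_im_kernelBorel_diag {f : (quasiSplit F E c 3).Adelic → ℂ} (hfc : Continuous f)
    (hf : HasCompactSupport f) (ν : Measure (adelicUnipotent F E c 3)) [SFinite ν] (𝓕 : Set (adelicUnipotent F E c 3)) :
    Measurable fun k : (quasiSplit F E c 3).Adelic => ENNReal.ofReal (kernelBorel ν 𝓕 f k k).im :=
  ENNReal.measurable_ofReal.comp (Complex.measurable_im.comp (measurable_kernelBorel_diag hfc hf ν 𝓕))

/-- `Θ₄(k) = ofReal (−im K_B(k,k))` is measurable. [cite: Rogawski1990, §2.2 (p. 13)] -/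
theorem measurable_ofReal_neg_im_kernelBorel_diag {f : (quasiSplit F E c 3).Adelic → ℂ} (hfc : Continuous f)
    (hf : HasCompactSupport f) (ν : Measure (adelicUnipotent F E c 3)) [SFinite ν] (𝓕 : Set (adelicUnipotent F E c 3)) :
    Measurable fun k : (quasiSplit F E c 3).Adelic => ENNReal.ofReal (-(kernelBorel ν 𝓕 f k k).im) :=
  ENNReal.measurable_ofReal.comp (Complex.measurable_im.comp (measurable_kernelBorel_diag hfc hf ν 𝓕)).neg

/-- The window `y ↦ 1_{T<H(y)≤T'} K_B(y,y)` is measurable. [cite: Rogawski1990, §2.2 (p. 13)] -/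
theorem measurable_window {f : (quasiSplit F E c 3).Adelic → ℂ} (hfc : Continuous f)
    (hf : HasCompactSupport f) (ν : Measure (adelicUnipotent F E c 3)) [SFinite ν] (𝓕 : Set (adelicUnipotent F E c 3))
    (T T' : ℝ≥0) :
    Measurable ({y : (quasiSplit F E c 3).Adelic | T < borelHeight y ∧ borelHeight y ≤ T'}.indicator
      fun y => kernelBorel ν 𝓕 f y y) :=
  (measurable_kernelBorel_diag hfc hf ν 𝓕).indicator
    (show MeasurableSet ((borelHeight : (quasiSplit F E c 3).Adelic → ℝ≥0) ⁻¹' Set.Ioc T T')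
      from measurable_borelHeight measurableSet_Ioc)

/-- `w₁ = ofReal (re window)` is measurable. [cite: Rogawski1990, §2.2 (p. 13)] -/
theorem measurable_ofReal_re_window {f : (quasiSplit F E c 3).Adelic → ℂ} (hfc : Continuous f)
    (hf : HasCompactSupport f) (ν : Measure (adelicUnipotent F E c 3)) [SFinite ν] (𝓕 : Set (adelicUnipotent F E c 3))
    (T T' : ℝ≥0) :
    Measurable fun y : (quasiSplit F E c 3).Adelic => ENNReal.ofReal
      ({y : (quasiSplit F E c 3).Adelic | T < borelHeight y ∧ borelHeight y ≤ T'}.indicator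
        (fun y => kernelBorel ν 𝓕 f y y) y).re :=
  ENNReal.measurable_ofReal.comp (Complex.measurable_re.comp (measurable_window hfc hf ν 𝓕 T T'))

/-- `w₂ = ofReal (−re window)` is measurable. [cite: Rogawski1990, §2.2 (p. 13)] -/
theorem measurable_ofReal_neg_re_window {f : (quasiSplit F E c 3).Adelic → ℂ} (hfc : Continuous f)
    (hf : HasCompactSupport f) (ν : Measure (adelicUnipotent F E c 3)) [SFinite ν] (𝓕 : Set (adelicUnipotent F E c 3))
    (T T' : ℝ≥0) :
    Measurable fun y : (quasiSplit F E c 3).Adelic => ENNReal.ofReal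
      (-({y : (quasiSplit F E c 3).Adelic | T < borelHeight y ∧ borelHeight y ≤ T'}.indicator
        (fun y => kernelBorel ν 𝓕 f y y) y).re) :=
  ENNReal.measurable_ofReal.comp (Complex.measurable_re.comp (measurable_window hfc hf ν 𝓕 T T')).neg

/-- `w₃ = ofReal (im window)` is measurable. [cite: Rogawski1990, §2.2 (p. 13)] -/
theorem measurable_ofReal_im_window {f : (quasiSplit F E c 3).Adelic → ℂ} (hfc : Continuous f)
    (hf : HasCompactSupport f) (ν : Measure (adelicUnipotent F E c 3)) [SFinite ν] (𝓕 : Set (adelicUnipotent F E c 3))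
    (T T' : ℝ≥0) :
    Measurable fun y : (quasiSplit F E c 3).Adelic => ENNReal.ofReal
      ({y : (quasiSplit F E c 3).Adelic | T < borelHeight y ∧ borelHeight y ≤ T'}.indicator
        (fun y => kernelBorel ν 𝓕 f y y) y).im :=
  ENNReal.measurable_ofReal.comp (Complex.measurable_im.comp (measurable_window hfc hf ν 𝓕 T T'))

/-- `w₄ = ofReal (−im window)` is measurable. [cite: Rogawski1990, §2.2 (p. 13)] -/
theorem measurable_ofReal_neg_im_window {f : (quasiSplit F E c 3).Adelic → ℂ} (hfc : Continuous f)
    (hf : HasCompactSupport f) (ν : Measure (adelicUnipotent F E c 3)) [SFinite ν] (𝓕 : Set (adelicUnipotent F E c 3))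
    (T T' : ℝ≥0) :
    Measurable fun y : (quasiSplit F E c 3).Adelic => ENNReal.ofReal
      (-({y : (quasiSplit F E c 3).Adelic | T < borelHeight y ∧ borelHeight y ≤ T'}.indicator
        (fun y => kernelBorel ν 𝓕 f y y) y).im) :=
  ENNReal.measurable_ofReal.comp (Complex.measurable_im.comp (measurable_window hfc hf ν 𝓕 T T')).neg

end Parts

/-! ## §4 The parts factor: `w_j(b k) = Φ(b) · Θ_j(k)` -/

section Factor

omit [MeasurableSpace (adelicUnipotent F E c 3)] [BorelSpace (adelicUnipotent F E c 3)] in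
/-- The real-part bookkeeping behind §4: for a real `δ ≥ 0`, an indicator and a linear form `ℓ ∈ {re, im, −re, −im}`
written as `ofReal (a · ℓ (s.indicator (δ • z)))`: `ofReal (ℓ' (1_s · δ • z)) = 1_s δ · ofReal (ℓ' z)` where
`ℓ'` is `re` or `im` possibly negated. Stated for `re`. [cite: Rogawski1990, §2.2 (p. 13)] -/
theorem ofReal_re_indicator_smul_eq (s : Set (borelAdelic F E c 3)) (b : borelAdelic F E c 3) (δ : borelAdelic F E c 3 → ℝ≥0)
    (z : ℂ) (a : ℝ) :
    ENNReal.ofReal (a * (s.indicator (fun b => (δ b : ℝ) • z) b).re) =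
      s.indicator (fun b => ((δ b : ℝ≥0) : ℝ≥0∞)) b * ENNReal.ofReal (a * z.re) := by
  by_cases hb : b ∈ s
  · rw [Set.indicator_of_mem hb, Set.indicator_of_mem hb, Complex.smul_re, smul_eq_mul,
      mul_left_comm, ENNReal.ofReal_mul (NNReal.coe_nonneg (δ b)), ENNReal.ofReal_coe_nnreal]
  · rw [Set.indicator_of_notMem hb, Set.indicator_of_notMem hb, Complex.zero_re, mul_zero, ENNReal.ofReal_zero,
      zero_mul]

omit [MeasurableSpace (adelicUnipotent F E c 3)] [BorelSpace (adelicUnipotent F E c 3)] in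
/-- The same bookkeeping for `im`. [cite: Rogawski1990, §2.2 (p. 13)] -/
theorem ofReal_im_indicator_smul_eq (s : Set (borelAdelic F E c 3)) (b : borelAdelic F E c 3) (δ : borelAdelic F E c 3 → ℝ≥0)
    (z : ℂ) (a : ℝ) :
    ENNReal.ofReal (a * (s.indicator (fun b => (δ b : ℝ) • z) b).im) =
      s.indicator (fun b => ((δ b : ℝ≥0) : ℝ≥0∞)) b * ENNReal.ofReal (a * z.im) := by
  by_cases hb : b ∈ s
  · rw [Set.indicator_of_mem hb, Set.indicator_of_mem hb, Complex.smul_im, smul_eq_mul,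
      mul_left_comm, ENNReal.ofReal_mul (NNReal.coe_nonneg (δ b)), ENNReal.ofReal_coe_nnreal]
  · rw [Set.indicator_of_notMem hb, Set.indicator_of_notMem hb, Complex.zero_im, mul_zero, ENNReal.ofReal_zero,
      zero_mul]

/-- **`w₁(b k) = Φ(b) · Θ₁(k)`**: `ofReal (re window(b k)) = 1_{T<H(b)≤T'} δ_B(b) · ofReal (re K_B(k,k))` for
`b ∈ B(𝔸_F)`, `k ∈ K_U` — the binder `hΨ` of ★ `lintegral_weight_iwasawa_eq_three` for the first part.
[cite: Rogawski1990, §2.2 (p. 13)] [cite: Arthur1981TraceFormulaInvariantForm, §2] -/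
theorem windowPart_re_borel_mul_eq (hc : c * c = 1) (hc1 : c ≠ 1)
    (ν : Measure (adelicUnipotent F E c 3)) [ν.IsHaarMeasure] {𝓕 : Set (adelicUnipotent F E c 3)}
    (h𝓕 : IsFundamentalDomain (rationalUnipotent F E c 3) 𝓕 ν)
    {f : (quasiSplit F E c 3).Adelic → ℂ} (hfc : Continuous f) (hf : HasCompactSupport f) (T T' : ℝ≥0)
    (b : borelAdelic F E c 3) (k : (quasiSplit F E c 3).Adelic)
    (hk : adelicVal F E c 3 ((StdForm.antidiagonal 3).over E) k ∈ standardMaximalCompactGL 3 E) :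
    ENNReal.ofReal ({y : (quasiSplit F E c 3).Adelic | T < borelHeight y ∧ borelHeight y ≤ T'}.indicator
        (fun y => kernelBorel ν 𝓕 f y y) ((b : (quasiSplit F E c 3).Adelic) * k)).re =
      {b : borelAdelic F E c 3 | T < borelHeight (b : (quasiSplit F E c 3).Adelic) ∧
          borelHeight (b : (quasiSplit F E c 3).Adelic) ≤ T'}.indicator
        (fun b => ((torusRootModulus E 3 (diagUnit b.2) : ℝ≥0) : ℝ≥0∞)) b *
      ENNReal.ofReal (kernelBorel ν 𝓕 f k k).re := by
  rw [window_borel_mul_of_mem_standardMaximalCompactGL hc hc1 ν h𝓕 hfc hf T T' b hk]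
  have h := ofReal_re_indicator_smul_eq
    {b : borelAdelic F E c 3 | T < borelHeight (b : (quasiSplit F E c 3).Adelic) ∧
      borelHeight (b : (quasiSplit F E c 3).Adelic) ≤ T'} b (fun b => torusRootModulus E 3 (diagUnit b.2))
    (kernelBorel ν 𝓕 f k k) 1
  simp only [one_mul] at h
  exact h

/-- **`w₂(b k) = Φ(b) · Θ₂(k)`** (negative real part). [cite: Rogawski1990, §2.2 (p. 13)] [cite: Arthur1981TraceFormulaInvariantForm, §2] -/
theorem windowPart_negRe_borel_mul_eq (hc : c * c = 1) (hc1 : c ≠ 1)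
    (ν : Measure (adelicUnipotent F E c 3)) [ν.IsHaarMeasure] {𝓕 : Set (adelicUnipotent F E c 3)}
    (h𝓕 : IsFundamentalDomain (rationalUnipotent F E c 3) 𝓕 ν)
    {f : (quasiSplit F E c 3).Adelic → ℂ} (hfc : Continuous f) (hf : HasCompactSupport f) (T T' : ℝ≥0)
    (b : borelAdelic F E c 3) (k : (quasiSplit F E c 3).Adelic)
    (hk : adelicVal F E c 3 ((StdForm.antidiagonal 3).over E) k ∈ standardMaximalCompactGL 3 E) :
    ENNReal.ofReal (-({y : (quasiSplit F E c 3).Adelic | T < borelHeight y ∧ borelHeight y ≤ T'}.indicator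
        (fun y => kernelBorel ν 𝓕 f y y) ((b : (quasiSplit F E c 3).Adelic) * k)).re) =
      {b : borelAdelic F E c 3 | T < borelHeight (b : (quasiSplit F E c 3).Adelic) ∧
          borelHeight (b : (quasiSplit F E c 3).Adelic) ≤ T'}.indicator
        (fun b => ((torusRootModulus E 3 (diagUnit b.2) : ℝ≥0) : ℝ≥0∞)) b *
      ENNReal.ofReal (-(kernelBorel ν 𝓕 f k k).re) := by
  rw [window_borel_mul_of_mem_standardMaximalCompactGL hc hc1 ν h𝓕 hfc hf T T' b hk]
  have h := ofReal_re_indicator_smul_eq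
    {b : borelAdelic F E c 3 | T < borelHeight (b : (quasiSplit F E c 3).Adelic) ∧
      borelHeight (b : (quasiSplit F E c 3).Adelic) ≤ T'} b (fun b => torusRootModulus E 3 (diagUnit b.2))
    (kernelBorel ν 𝓕 f k k) (-1)
  simp only [neg_mul, one_mul] at h
  exact h

/-- **`w₃(b k) = Φ(b) · Θ₃(k)`** (imaginary part). [cite: Rogawski1990, §2.2 (p. 13)] [cite: Arthur1981TraceFormulaInvariantForm, §2] -/
theorem windowPart_im_borel_mul_eq (hc : c * c = 1) (hc1 : c ≠ 1)
    (ν : Measure (adelicUnipotent F E c 3)) [ν.IsHaarMeasure] {𝓕 : Set (adelicUnipotent F E c 3)}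
    (h𝓕 : IsFundamentalDomain (rationalUnipotent F E c 3) 𝓕 ν)
    {f : (quasiSplit F E c 3).Adelic → ℂ} (hfc : Continuous f) (hf : HasCompactSupport f) (T T' : ℝ≥0)
    (b : borelAdelic F E c 3) (k : (quasiSplit F E c 3).Adelic)
    (hk : adelicVal F E c 3 ((StdForm.antidiagonal 3).over E) k ∈ standardMaximalCompactGL 3 E) :
    ENNReal.ofReal ({y : (quasiSplit F E c 3).Adelic | T < borelHeight y ∧ borelHeight y ≤ T'}.indicator
        (fun y => kernelBorel ν 𝓕 f y y) ((b : (quasiSplit F E c 3).Adelic) * k)).im =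
      {b : borelAdelic F E c 3 | T < borelHeight (b : (quasiSplit F E c 3).Adelic) ∧
          borelHeight (b : (quasiSplit F E c 3).Adelic) ≤ T'}.indicator
        (fun b => ((torusRootModulus E 3 (diagUnit b.2) : ℝ≥0) : ℝ≥0∞)) b *
      ENNReal.ofReal (kernelBorel ν 𝓕 f k k).im := by
  rw [window_borel_mul_of_mem_standardMaximalCompactGL hc hc1 ν h𝓕 hfc hf T T' b hk]
  have h := ofReal_im_indicator_smul_eq
    {b : borelAdelic F E c 3 | T < borelHeight (b : (quasiSplit F E c 3).Adelic) ∧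
      borelHeight (b : (quasiSplit F E c 3).Adelic) ≤ T'} b (fun b => torusRootModulus E 3 (diagUnit b.2))
    (kernelBorel ν 𝓕 f k k) 1
  simp only [one_mul] at h
  exact h

/-- **`w₄(b k) = Φ(b) · Θ₄(k)`** (negative imaginary part). [cite: Rogawski1990, §2.2 (p. 13)] [cite: Arthur1981TraceFormulaInvariantForm, §2] -/
theorem windowPart_negIm_borel_mul_eq (hc : c * c = 1) (hc1 : c ≠ 1)
    (ν : Measure (adelicUnipotent F E c 3)) [ν.IsHaarMeasure] {𝓕 : Set (adelicUnipotent F E c 3)}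
    (h𝓕 : IsFundamentalDomain (rationalUnipotent F E c 3) 𝓕 ν)
    {f : (quasiSplit F E c 3).Adelic → ℂ} (hfc : Continuous f) (hf : HasCompactSupport f) (T T' : ℝ≥0)
    (b : borelAdelic F E c 3) (k : (quasiSplit F E c 3).Adelic)
    (hk : adelicVal F E c 3 ((StdForm.antidiagonal 3).over E) k ∈ standardMaximalCompactGL 3 E) :
    ENNReal.ofReal (-({y : (quasiSplit F E c 3).Adelic | T < borelHeight y ∧ borelHeight y ≤ T'}.indicator
        (fun y => kernelBorel ν 𝓕 f y y) ((b : (quasiSplit F E c 3).Adelic) * k)).im) =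
      {b : borelAdelic F E c 3 | T < borelHeight (b : (quasiSplit F E c 3).Adelic) ∧
          borelHeight (b : (quasiSplit F E c 3).Adelic) ≤ T'}.indicator
        (fun b => ((torusRootModulus E 3 (diagUnit b.2) : ℝ≥0) : ℝ≥0∞)) b *
      ENNReal.ofReal (-(kernelBorel ν 𝓕 f k k).im) := by
  rw [window_borel_mul_of_mem_standardMaximalCompactGL hc hc1 ν h𝓕 hfc hf T T' b hk]
  have h := ofReal_im_indicator_smul_eq
    {b : borelAdelic F E c 3 | T < borelHeight (b : (quasiSplit F E c 3).Adelic) ∧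
      borelHeight (b : (quasiSplit F E c 3).Adelic) ≤ T'} b (fun b => torusRootModulus E 3 (diagUnit b.2))
    (kernelBorel ν 𝓕 f k k) (-1)
  simp only [neg_mul, one_mul] at h
  exact h

end Factor

end UnitaryGroup

end Literature.NumberTheory.Automorphic
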